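import Literature.AlgebraicGeometry.ModuliOfAbelianVarieties.SiegelFineModuliSchemeLevelKernelAction
import Literature.AlgebraicGeometry.AbelianSchemes.PolarizedTripleRigidityOfFiniteType
import Literature.AlgebraicGeometry.AbelianSchemes.PolarizedAbelianSchemeWithLevelBaseChangeUnique
import Literature.AlgebraicGeometry.AbelianSchemes.LevelStructureTwistLocallyConstant
import Literature.AlgebraicGeometry.AbelianSchemes.LevelStructureTwistChangeLevel
import HarnessLib

/-!
# The level-descent action on `A_{g,δ,N}` is FREE: trivial inertia on geometric points (Serre's lemma)
# ([MFK94] Ch. 7 §3, remark after Thm. 7.9 p. 139, Lemma 7.11 p. 140; [Deligne 1971] 4.16)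

Topic `AlgebraicGeometry/ModuliOfAbelianVarieties`; namespace
`Literature.AlgebraicGeometry.ModuliOfAbelianVarieties.SiegelFineModuliScheme`.  THEOREMS ONLY (no definition, no named
fact, no instance, no notation, no `sorry`; net Literature debt 0).  Cell hodgecm-mathlib (D-0151), F-DAG leaf F-10 (b),
brick (Q-free) over ★ (Q-lite) `SiegelFineModuliSchemeLevelKernelAction` (`exists_levelKernel_finite_action`: the finite
action `act : Δ →* Aut M`, `Δ = red(K_δ(N₀)) ≤ GL_{2g}(ℤ/N)`, through the twist operators).  [MumfordFogartyKirwan1994]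
Ch. 7 §3 p. 139: «by the lemma of Serre, `Γ` acts freely on `A_{g,d,n}`» (an automorphism of a polarised abelian variety
which is the identity on the points of order `n₀ ≥ 3` is the identity), so that `A_{g,d,n} → A_{g,d,n}/Γ` is a finite
étale Galois covering (Lemma 7.11); [Deligne1971TravauxShimura] 4.16.  Here: for `N = N₀ d`, `3 ≤ N₀`, and `M` locally of
finite type over `ℚ` (the quasi-projective carrier), NO `x ≠ 1` of `Δ` FIXES A GEOMETRIC POINT of `M` — verbatim the
hypothesis `hpt` of ★ `ActionOver.free_of_forall_comp_aut_ne`, whence the level-descent quotient `M → M/Δ` is finite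
ÉTALE surjective and flat (★ `IsGeometricQuotient.isFinite_etale_surjective_of_free`, `flat_of_free`): the input of
F-10 (b3) (`T ×_Q M → T` is an fpqc cover) and of (10a) (`hfree`).  Proof through the FIXED LOCUS `Z = Eq(act x, 𝟙)`
(Mathlib equalizer, an immersion, so `Z` is locally Noetherian and locally of finite type over `ℚ`): over `Z` the triples
`𝒰|_Z` and `𝒰|_Z · γ̄` (`x = γ̄ = red γ`, `γ ∈ K_δ(N₀)`; liftable by ★ `isSymplecticLiftable_twist_of_mem_principalLevelSubgroup_one`)
have the same classifying map (★ `classifyingMap_comp_classifyingMap_twist`, `Z` is fixed), hence are related along `𝟙 Z`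
by `(H, Ĥ)` (★ `exists_isBaseChangeVia_id_of_isBaseChangeVia`); as `γ̄ ≡ 1 (mod N₀)` (★
`mem_principalLevelSubgroup_iff_forall_integralAdeleResidue_eq`, `castHom_comp_integralAdeleResidue`, ★
`changeLevel_twist_of_map_eq_one`) the pair `(H, Ĥ)` is an automorphism of the level-`N₀` triple `(𝒰|_Z).changeLevel N₀`,
so `H = 𝟙` by ★ RIGIDITY `eq_id_and_hat_eq_id_of_locallyOfFiniteType_rat`; then `𝒰|_Z.level · γ̄ = 𝒰|_Z.level` and ★
`twist_eq_one_of_restrict_σ_eq` at the point of `Z` under the fixed geometric point gives `γ̄ = 1`.  HC_CM is proved only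
modulo the 7 printed citations until rung 0 closes; this file discharges none of them (count-neutral capital).

* **`levelKernel_action_comp_ne`** — `x ≠ 1 → t ≫ (act x).hom.left ≠ t` for every geometric point `t` of `M`.

Mathlib searched (pin): `equalizer.ι/condition/lift`, the instance `IsImmersion (equalizer.ι f g)` (⇒ locally of finite
type), `LocallyOfFiniteType.isLocallyNoetherian`, `Functor.isCommMonObj_obj` (all used).

## References
* D. Mumford, J. Fogarty, F. Kirwan, *Geometric Invariant Theory*, 3rd ed. (1994), Ch. 7 §3, remark after Theorem 7.9
  (p. 139), Lemma 7.11 (p. 140). [MumfordFogartyKirwan1994]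
* P. Deligne, *Travaux de Shimura*, Sém. Bourbaki 389 (1971), 4.16 p. 150; Exemple 4.16 p. 150. [Deligne1971TravauxShimura]
-/

noncomputable section

open CategoryTheory CategoryTheory.Limits AlgebraicGeometry

namespace Literature.AlgebraicGeometry.ModuliOfAbelianVarieties

open Literature.AlgebraicGeometry.Motives (SchemeOver)
open Literature.AlgebraicGeometry.AbelianSchemes (PolarizedAbelianSchemeWithLevel)
open Literature.AlgebraicGeometry.AbelianSchemes.AbelianSchemeOver
open Literature.NumberTheory.Adeles NumberField IsDedekindDomain

namespace SiegelFineModuliScheme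

variable {g N : ℕ} {δ : Fin g → ℕ} (𝓜 : SiegelFineModuliScheme g N δ) [IsCommMonObj 𝓜.univ.A.X] [NeZero N]

/-- The reduction of `γ ∈ K_δ(N₀)` modulo `N = N₀ d`, read modulo `N₀`, is `1`. [cite: Deligne1971TravauxShimura, Exemple 4.16 p. 150] -/
private theorem map_castHom_eq_one_of_mem {N₀ d : ℕ} [NeZero N₀] (hd : N = N₀ * d)
    (red : principalLevelSubgroup δ 1 →* GL (Fin g ⊕ Fin g) (ZMod N))
    (hred : ∀ (k : principalLevelSubgroup δ 1) (i j : Fin g ⊕ Fin g)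
      (h : (((k : gspFinAdelic δ) : GL (Fin g ⊕ Fin g) finAdeleQ) :
        Matrix (Fin g ⊕ Fin g) (Fin g ⊕ Fin g) finAdeleQ) i j ∈ FiniteAdeleRing.integralAdeles (𝓞 ℚ) ℚ),
      ((red k : GL (Fin g ⊕ Fin g) (ZMod N)) : Matrix (Fin g ⊕ Fin g) (Fin g ⊕ Fin g) (ZMod N)) i j =
        integralAdeleResidue N ⟨_, h⟩)
    (k : principalLevelSubgroup δ 1) (hk : (k : gspFinAdelic δ) ∈ principalLevelSubgroup δ N₀) :
    Matrix.GeneralLinearGroup.map (ZMod.castHom (⟨d, hd⟩ : N₀ ∣ N) (ZMod N₀)) (red k) = 1 := by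
  have h1 := (mem_principalLevelSubgroup_iff_forall_integralAdeleResidue_eq N₀ δ k.2).1 hk
  refine Units.ext (Matrix.ext fun i j => ?_)
  have hint := isIntegral_of_isCongOne_one ((mem_principalLevelSubgroup_iff δ).1 k.2).1 i j
  rw [Matrix.GeneralLinearGroup.map_apply, Units.val_one, hred k i j hint, ← RingHom.comp_apply,
    castHom_comp_integralAdeleResidue]
  exact h1 i j

/-- **THE LEVEL-DESCENT ACTION HAS TRIVIAL INERTIA (Serre's lemma on `A_{g,δ,N}`)** — [MumfordFogartyKirwan1994] Ch. 7 §3,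
remark after Thm. 7.9 (p. 139) and Lemma 7.11 (p. 140): `Γ = Γ_{N₀}^{(d)}` acts FREELY on `A_{g,d,N}` when `N₀ ≥ 3`,
because an automorphism of a polarised abelian variety fixing the points of order `N₀ ≥ 3` is the identity (lemma of
Serre); [Deligne1971TravauxShimura] 4.16: `_{K_n}M → _{K}M` is étale Galois.  For the finite action
`act : Δ →* Aut M` of ★ `exists_levelKernel_finite_action` (any data `red, Δ, act` with its clauses), `N = N₀ d`,
`3 ≤ N₀`, and `M` locally of finite type over `ℚ`: no `x ≠ 1` of `Δ` fixes a geometric point of `M` — verbatim the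
hypothesis of ★ `ActionOver.free_of_forall_comp_aut_ne`, whence the quotient `M → M/Δ` is finite ÉTALE surjective (★
`IsGeometricQuotient.isFinite_etale_surjective_of_free`).  Proof through the FIXED LOCUS `Z = Eq((act x), 𝟙) ⊆ M`
(Mathlib equalizer; locally of finite type over `ℚ`): over `Z` the universal triple `𝒰|_Z` and its twist `𝒰|_Z · γ̄`
(`γ̄ = red γ`, `x = red γ`, `γ ∈ K_δ(N₀)`) have the same classifying map (★ `classifyingMap_comp_classifyingMap_twist`),
so they are related along `𝟙 Z` (★ `exists_isBaseChangeVia_id_of_isBaseChangeVia`); since `γ̄ ≡ 1 (mod N₀)` the relating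
pair `(H, Ĥ)` is an automorphism of the level-`N₀` triple `(𝒰|_Z).changeLevel N₀` (★ `changeLevel_twist_of_map_eq_one`),
hence `H = 𝟙` by RIGIDITY (★ `eq_id_and_hat_eq_id_of_locallyOfFiniteType_rat`); then `𝒰|_Z.level · γ̄ = 𝒰|_Z.level`, and at
the point of `Z` under the fixed geometric point ★ `twist_eq_one_of_restrict_σ_eq` gives `γ̄ = 1`, i.e. `x = 1`.
[cite: MumfordFogartyKirwan1994, Ch. 7 §3, remark after Theorem 7.9 (p. 139) and Lemma 7.11 (p. 140)]
[cite: Deligne1971TravauxShimura, 4.16 p. 150] -/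
theorem levelKernel_action_comp_ne [LocallyOfFiniteType 𝓜.M.hom] (hδ : IsPolarizationType δ) (hg : 0 < g)
    {N₀ d : ℕ} [NeZero N₀] (hd : N = N₀ * d) (hN₀ : 3 ≤ N₀)
    (red : principalLevelSubgroup δ 1 →* GL (Fin g ⊕ Fin g) (ZMod N))
    (Δ : Subgroup (GL (Fin g ⊕ Fin g) (ZMod N))) (act : Δ →* Aut 𝓜.M)
    (hred : ∀ (k : principalLevelSubgroup δ 1) (i j : Fin g ⊕ Fin g)
      (h : (((k : gspFinAdelic δ) : GL (Fin g ⊕ Fin g) finAdeleQ) :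
        Matrix (Fin g ⊕ Fin g) (Fin g ⊕ Fin g) finAdeleQ) i j ∈ FiniteAdeleRing.integralAdeles (𝓞 ℚ) ℚ),
      ((red k : GL (Fin g ⊕ Fin g) (ZMod N)) : Matrix (Fin g ⊕ Fin g) (Fin g ⊕ Fin g) (ZMod N)) i j =
        integralAdeleResidue N ⟨_, h⟩)
    (hΔ : ∀ x : Δ, ∃ k : principalLevelSubgroup δ 1, (k : gspFinAdelic δ) ∈ principalLevelSubgroup δ N₀ ∧ red k = x)
    (hop : ∀ (k : principalLevelSubgroup δ 1) (hk : red k ∈ Δ),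
      ∃ hs : (𝓜.univ.level.twist (red k)).IsSymplecticLiftable 𝓜.univ.pol δ,
        (act ⟨red k, hk⟩).inv = (haveI := 𝓜.isLocallyNoetherian
          𝓜.classifyingMap 𝓜.M ({ 𝓜.univ with level := 𝓜.univ.level.twist (red k), symplectic := hs } :
            PolarizedAbelianSchemeWithLevel g N δ 𝓜.M.left)))
    {Ω : Type} [Field Ω] [IsAlgClosed Ω] (t : Spec (.of Ω) ⟶ 𝓜.M.left) (x : Δ) (hx : x ≠ 1) :
    t ≫ (act x).hom.left ≠ t := by
  haveI := 𝓜.isLocallyNoetherian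
  intro ht
  -- `x = red k`, `k ∈ K_δ(N₀)`; the twist operator `T = (act x)⁻¹`
  obtain ⟨k, hkN₀, hkx⟩ := hΔ x
  have hkΔ : red k ∈ Δ := by rw [hkx]; exact x.2
  have hxk : x = ⟨red k, hkΔ⟩ := Subtype.ext hkx.symm
  subst hxk
  obtain ⟨hs, hT⟩ := hop k hkΔ
  -- the fixed locus `Z` of `act x`, locally Noetherian and locally of finite type over `ℚ`
  let ι : equalizer (act ⟨red k, hkΔ⟩).hom.left (𝟙 _) ⟶ 𝓜.M.left := equalizer.ι _ _
  haveI : IsLocallyNoetherian (equalizer (act ⟨red k, hkΔ⟩).hom.left (𝟙 𝓜.M.left)) :=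
    LocallyOfFiniteType.isLocallyNoetherian ι
  have hιfix : ι ≫ (act ⟨red k, hkΔ⟩).hom.left = ι := by
    have h := equalizer.condition (act ⟨red k, hkΔ⟩).hom.left (𝟙 𝓜.M.left)
    rw [Category.comp_id] at h
    exact h
  have hιinv : ι ≫ (act ⟨red k, hkΔ⟩).inv.left = ι := by
    conv_lhs => rw [← hιfix]
    rw [Category.assoc, ← Over.comp_left, Iso.hom_inv_id, Over.id_left, Category.comp_id]
  let Z : SchemeOver ℚ := Over.mk (ι ≫ 𝓜.M.hom)
  haveI : IsLocallyNoetherian Z.left :=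
    inferInstanceAs (IsLocallyNoetherian (equalizer (act ⟨red k, hkΔ⟩).hom.left (𝟙 𝓜.M.left)))
  let ιO : Z ⟶ 𝓜.M := Over.homMk ι rfl
  -- the universal triple over `Z` and its twist by `red k`
  let P : PolarizedAbelianSchemeWithLevel g N δ Z.left := 𝓜.univ.baseChange ι
  haveI : IsCommMonObj P.A.X :=
    ⟨(Functor.isCommMonObj_obj (F := Over.pullback ι) (M := 𝓜.univ.A.X)).mul_comm⟩
  have hsP : (P.level.twist (red k)).IsSymplecticLiftable P.pol δ :=
    isSymplecticLiftable_twist_of_mem_principalLevelSubgroup_one δ hδ hg k.2 (red k) (hred k) P.symplectic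
  let P' : PolarizedAbelianSchemeWithLevel g N δ Z.left := { P with level := P.level.twist (red k), symplectic := hsP }
  -- both have classifying map `ιO`
  have hcmP : 𝓜.classifyingMap Z P = ιO := by
    have h := 𝓜.classifyingMap_comp ιO 𝓜.univ P (𝓜.univ.baseChange_isBaseChangeVia ι)
    rw [𝓜.classifyingMap_self, Category.comp_id] at h
    exact h.symm
  have hcmP' : 𝓜.classifyingMap Z P' = ιO := by
    have h := 𝓜.classifyingMap_comp_classifyingMap_twist (red k) hs Z P hsP
    rw [hcmP, ← hT] at h
    rw [← h]
    ext
    rw [Over.comp_left]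
    exact hιinv
  -- hence they are related along `𝟙 Z` by isomorphisms `(H, Ĥ)`
  obtain ⟨G₁, Ĝ₁, h₁⟩ := 𝓜.exists_isBaseChangeVia_classifyingMap Z P
  obtain ⟨G₂, Ĝ₂, h₂⟩ := 𝓜.exists_isBaseChangeVia_classifyingMap Z P'
  rw [hcmP] at h₁
  rw [hcmP'] at h₂
  obtain ⟨H, Ĥ, -, -, -, -, hrel⟩ := h₁.exists_isBaseChangeVia_id_of_isBaseChangeVia h₂
  obtain ⟨hl, hh, hPo, hlam⟩ := hrel
  -- `red k ≡ 1 (mod N₀)`: `(H, Ĥ)` is an automorphism of the level-`N₀` triple `P.changeLevel N₀`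
  have hN : N ≠ 0 := NeZero.ne N
  have h1 := map_castHom_eq_one_of_mem (δ := δ) hd red hred k hkN₀
  have hl₀ : (P.level.changeLevel N₀ d hd hN).IsBaseChangeVia (P.level.changeLevel N₀ d hd hN) (𝟙 Z.left) H := by
    have h := hl.changeLevel P.level N₀ d hd hN
    rwa [LevelStructure.changeLevel_twist_of_map_eq_one P.level (red k) d hd hN h1] at h
  have hauto : (P.changeLevel N₀ d hd hN).IsBaseChangeVia (P.changeLevel N₀ d hd hN) (𝟙 Z.left) H Ĥ :=
    ⟨hl₀, hh, hPo, hlam⟩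
  -- RIGIDITY: `H = 𝟙`
  obtain ⟨hH, -⟩ := PolarizedAbelianSchemeWithLevel.eq_id_and_hat_eq_id_of_locallyOfFiniteType_rat (ι ≫ 𝓜.M.hom)
    (P.changeLevel N₀ d hd hN) hN₀ hauto
  -- so the twisted and untwisted level-`N` structures have the same sections
  have hσ : ∀ i, (P.level.twist (red k)).σ i = P.level.σ i := fun i => by
    ext
    have h := hl.2 i
    rw [hH] at h
    erw [Category.comp_id, Category.id_comp] at h
    exact h
  -- at the point of `Z` under the fixed geometric point, the twisting action is free
  let tZ : Spec (.of Ω) ⟶ Z.left := equalizer.lift t (by rw [ht, Category.comp_id])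
  have hone : red k = 1 :=
    LevelStructure.twist_eq_one_of_restrict_σ_eq P.level (red k) tZ fun i => by rw [hσ i]
  exact hx (Subtype.ext (by change red k = ((1 : Δ) : GL (Fin g ⊕ Fin g) (ZMod N)); rw [hone]; rfl))

end SiegelFineModuliScheme

end Literature.AlgebraicGeometry.ModuliOfAbelianVarieties

end
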